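import Literature.AnabelianGeometry.SemiGraphs.FiniteEtaleCoveringAlignedLift
import Literature.AnabelianGeometry.SemiGraphs.ComponentsReadBack
import Literature.AnabelianGeometry.SemiGraphs.HomComposition

/-!
# The LOCAL clause of a composite of finite étale coverings ([SemiAnbd] §2, Def. 2.2 (i), Rmk. 2.4.2)

Mochizuki, *Semi-graphs of anabelioids*, Publ. RIMS **42** (2006) 221–322, §2: Definition 2.2 (i) and
the construction before it, author's manuscript p. 23 (the finite étale covering attached to
`G' ∈ B(𝒢)`: vertices/edges over `v`/`e` are the components of `S_v`/`T_e`, constituents the component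
anabelioids, branches placed through the gluing `ψ_b`), and Remark 2.4.1 p. 26, whose universally
sub-coverticial clause rests on "the composite of finite étale coverings is a finite étale covering"
(Remark 2.4.2: 1-morphisms of semi-graphs of anabelioids compose). [cite: MochizukiSemiAnbd2006, Def. 2.2(i) p.23]

PROOF-ONLY (abc-iut cell, layer L3, row «COMP-LOCAL»; FACT-LIST F-1478 residual, holder abc-iut-f-161:
the tree reduces `remark_2_4_1_covering` to the stability of `Hom.IsFiniteEtaleCoveringGlobal` under
`Hom.comp`, of which the GLOBAL clause is `Hom.IsGlobalCoveringOf.comp`, `FiniteEtaleCoveringComp.lean`).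
This file proves the LOCAL clause of a composite `χ.comp ψ : 𝒢 → ℋ → 𝒦` from ALIGNED local data of
`ψ` (`Hom.AlignedLocalData`, `FiniteEtaleCoveringAlignedLift.lean`):

* `componentIn_branch` — the abstract branch step: for equivalences `αV : C₁_{/P} ⥤ D₁`,
  `αE : C₂_{/Q} ⥤ D₂` intertwining a branch functor `pbH : D₁ ⥤ D₂` of the covering with a functor
  `G : C₁_{/P} ⥤ C₂_{/Q}` lying over a branch functor `pbK : C₁ ⥤ C₂` of the base (`β : αV ⋙ pbH ≅ G ⋙ αE`),
  a component `L ⊆ αE Y'` placed under `K ⊆ αV Y` through `β` and a gluing `γ : G Y ≅ Y'` is read back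
  to a component of the base placed under the read-back of `K` through the base's gluing;
* `AlignedLocalData.compV/compE` — the labels of the composite (`componentIn` of
  `ComponentsReadBack.lean` at the vertex/edge pieces), with `sigmaV_bijective`/`sigmaE_bijective`;
* `Hom.IsFiniteEtaleCoveringOf.comp_of_alignedLocalData` — **for `𝔇 : ψ.AlignedLocalData A`,
  `X ∈ B(𝒦)_{/A}` and `χ : 𝒢 → ℋ` with `χ.IsFiniteEtaleCoveringOf (𝔇.lift.obj X)`, the composite
  `χ.comp ψ` satisfies `IsFiniteEtaleCoveringOf` over `X.left`.**

Honest framing: this is the local clause of «finite étale coverings compose» CONDITIONAL on aligned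
local data for `ψ` whose lift hits the object `χ` is attached to; that every covering in print's sense
(`Hom.IsFiniteEtaleCoveringGlobal`) admits such data with `lift` an equivalence `≅ ψ^*`-compatibly is
the comparison theorem with print's construction (Bass's covering theory of graphs of groups) and is
NOT proved here.  No definition of a notion, no named fact; nothing here takes a side on [IUTchIII]
Cor. 3.12.
-/

namespace Literature.AnabelianGeometry.SemiGraphs

open CategoryTheory CategoryTheory.Limits CategoryTheory.PreGaloisCategory
open Literature.AnabelianGeometry.Anabelioids

universe v₁ v₂ v₃ v₄ u₁ u₂ u₃ u₄ u

-- Mathlib's `Over.pullback` / `Over.post` simp lemmas only fire under the pre-v4.2x defeq transparency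
-- behaviour, exactly as in `Mathlib/CategoryTheory/Comma/Over/Pullback.lean` (also: `π₀Obj` coercions).
set_option backward.isDefEq.respectTransparency false

/-! ### Casting components along equalities of objects -/

section Cast

variable {C : Type u₁} [Category.{v₁} C]

/-- Transport of connected components along an equality of objects.
[cite: MochizukiSemiAnbd2006, Def. 2.2(i) p.23] -/
def castObj {X₁ X₂ : C} (h : X₁ = X₂) (L : π₀Obj X₁) : π₀Obj X₂ :=
  Eq.mpr (congrArg π₀Obj h.symm) L

/-- A subobject below a monomorphism `g` followed by `eqToHom` is, after casting, below `g`.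
[cite: MochizukiSemiAnbd2006, Def. 2.2(i) p.23] -/
theorem exists_fac_castObj {X₁ X₂ M : C} (h : X₁ = X₂) (L : π₀Obj X₂) (g : M ⟶ X₁)
    (t : (L.1 : C) ⟶ M) (ht : t ≫ g ≫ eqToHom h = L.1.arrow) :
    ∃ t' : ((castObj h.symm L).1 : C) ⟶ M, t' ≫ g = (castObj h.symm L).1.arrow := by
  subst h
  refine ⟨t, ?_⟩
  change t ≫ g = L.1.arrow
  simpa using ht

end Cast

namespace SemiGraphOfAnabelioids

/-! ### Casting components along equalities of edges -/

section CastT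

variable {𝒦 : SemiGraphOfAnabelioids.{v₁, u₁, u}} (D : 𝒦.BObj)

/-- Transport of a connected component of `T_{e₂}` to `T_{e₁}` along `e₁ = e₂` (the home edge of a branch
versus the image edge, `edgeOf (φ b) = φ (edgeOf b)`). [cite: MochizukiSemiAnbd2006, Def. 2.2(i) p.23] -/
def BObj.castT {e₁ e₂ : 𝒦.graph.Edge} (h : e₁ = e₂) (Q : π₀Obj (D.T e₂)) : π₀Obj (D.T e₁) :=
  Eq.mpr (congrArg (fun e => π₀Obj (D.T e)) h) Q

/-- As points of `Σ e, π₀(T_e)` the cast component is the original one.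
[cite: MochizukiSemiAnbd2006, Def. 2.2(i) p.23] -/
theorem BObj.sigma_mk_castT {e₁ e₂ : 𝒦.graph.Edge} (h : e₁ = e₂) (Q : π₀Obj (D.T e₂)) :
    (⟨e₁, D.castT h Q⟩ : Σ e, π₀Obj (D.T e)) = ⟨e₂, Q⟩ := by
  subst h; rfl

/-- UNPACKING the branch clause of `Hom.IsFiniteEtaleCoveringOf` (transport form) into a factorisation
at the home edge. [cite: MochizukiSemiAnbd2006, Def. 2.2(i) p.23] -/
theorem BObj.exists_fac_castT_of_transport {e₁ e₂ : 𝒦.graph.Edge} (h : e₁ = e₂) (Q : π₀Obj (D.T e₂))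
    {M : 𝒦.E e₁} (g : M ⟶ D.T e₁) (t : (Q.1 : 𝒦.E e₂) ⟶ (𝒦.transportE h).obj M)
    (ht : t ≫ (𝒦.transportE h).map g ≫ eqToHom (𝒦.transportE_obj_T D h) = Q.1.arrow) :
    ∃ t' : ((D.castT h Q).1 : 𝒦.E e₁) ⟶ M, t' ≫ g = (D.castT h Q).1.arrow := by
  subst h
  refine ⟨t, ?_⟩
  change t ≫ g ≫ 𝟙 _ = Q.1.arrow at ht
  change t ≫ g = Q.1.arrow
  simpa using ht

/-- PACKING a factorisation at the home edge into the branch clause of `Hom.IsFiniteEtaleCoveringOf`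
(transport form). [cite: MochizukiSemiAnbd2006, Def. 2.2(i) p.23] -/
theorem BObj.exists_transport_of_fac_castT {e₁ e₂ : 𝒦.graph.Edge} (h : e₁ = e₂) (Q : π₀Obj (D.T e₂))
    {M : 𝒦.E e₁} (g : M ⟶ D.T e₁) (t' : ((D.castT h Q).1 : 𝒦.E e₁) ⟶ M)
    (ht' : t' ≫ g = (D.castT h Q).1.arrow) :
    ∃ t : (Q.1 : 𝒦.E e₂) ⟶ (𝒦.transportE h).obj M,
      t ≫ (𝒦.transportE h).map g ≫ eqToHom (𝒦.transportE_obj_T D h) = Q.1.arrow := by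
  subst h
  refine ⟨t', ?_⟩
  change t' ≫ g = Q.1.arrow at ht'
  change t' ≫ g ≫ 𝟙 _ = Q.1.arrow
  simpa using ht'

end CastT

/-! ### The abstract branch step -/

section Branch

variable {C₁ : Type u₁} [Category.{v₁} C₁] [GaloisCategory C₁]
  {C₂ : Type u₂} [Category.{v₂} C₂] [GaloisCategory C₂]
  {D₁ : Type u₃} [Category.{v₃} D₁] {D₂ : Type u₄} [Category.{v₄} D₂]

/-- **The abstract branch step.**  Data: equivalences `αV : C₁_{/P} ⥤ D₁`, `αE : C₂_{/Q} ⥤ D₂` (local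
equivalences of the second covering at a vertex and at the edge of a branch), a functor `pbH : D₁ ⥤ D₂`
(the branch functor of the intermediate semi-graph of anabelioids), a functor `G : C₁_{/P} ⥤ C₂_{/Q}`
with `β : αV ⋙ pbH ≅ G ⋙ αE` (functor-level branch alignment) lying over `pbK : C₁ ⥤ C₂` (the branch
functor of the base) through projections `pr`, objects `Y`, `Y'` glued by `γ : G Y ≅ Y'` over a gluing
`gl : pbK Z₁ → Z₂` of the base (`hγ`).  If a component `L ⊆ αE Y'` lies under `pbH K`, `K ⊆ αV Y`, through
the gluing `β_Y ≫ αE γ` of the lift, then the component of `Z₂` named by `L` lies under `pbK` of the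
component of `Z₁` named by `K`, through `gl` — print's "branches of the covering abut as the
components dictate", composed. [cite: MochizukiSemiAnbd2006, Def. 2.2(i) p.23] -/
theorem componentIn_branch {P : C₁} {Q : C₂} (αV : Over P ⥤ D₁) [αV.IsEquivalence]
    (αE : Over Q ⥤ D₂) [αE.IsEquivalence] (pbH : D₁ ⥤ D₂) (G : Over P ⥤ Over Q)
    (β : αV ⋙ pbH ≅ G ⋙ αE) (pbK : C₁ ⥤ C₂) (pr : ∀ U : Over P, (G.obj U).left ⟶ pbK.obj U.left)
    (hpr : ∀ {U U' : Over P} (g : U ⟶ U'), (G.map g).left ≫ pr U' = pr U ≫ pbK.map g.left)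
    (Y : Over P) (Y' : Over Q) (γ : G.obj Y ≅ Y') {Z₁ : C₁} {Z₂ : C₂} (fst : Y.left ⟶ Z₁) [Mono fst]
    (fst' : Y'.left ⟶ Z₂) [Mono fst'] (gl : pbK.obj Z₁ ⟶ Z₂)
    (hγ : γ.hom.left ≫ fst' = pr Y ≫ pbK.map fst ≫ gl)
    (K : π₀Obj (αV.obj Y)) (L : π₀Obj (αE.obj Y')) (t : (L.1 : D₂) ⟶ pbH.obj (K.1 : D₁))
    (ht : t ≫ pbH.map K.1.arrow ≫ β.hom.app Y ≫ αE.map γ.hom = L.1.arrow) :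
    ∃ s : ((componentIn αE Y' fst' L).1 : C₂) ⟶ pbK.obj ((componentIn αV Y fst K).1 : C₁),
      s ≫ pbK.map (componentIn αV Y fst K).1.arrow ≫ gl = (componentIn αE Y' fst' L).1.arrow := by
  -- the morphism `αE⁻¹ L → G (αV⁻¹ K)` in `C₂_{/Q}`
  obtain ⟨τ, hτ⟩ : ∃ τ : readBack αE Y' L ⟶ G.obj (readBack αV Y K),
      τ = αE.asEquivalence.inverse.map (t ≫ pbH.map (αV.asEquivalence.counitIso.inv.app (K.1 : D₁)) ≫
        β.hom.app (readBack αV Y K)) ≫ αE.asEquivalence.unitIso.inv.app (G.obj (readBack αV Y K)) :=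
    ⟨_, rfl⟩
  -- CLAIM: `τ ≫ G (αV⁻¹K → Y) ≫ γ` is `αE⁻¹ L → Y'`
  have h1 : αE.map τ = αE.asEquivalence.counitIso.hom.app (L.1 : D₂) ≫
      (t ≫ pbH.map (αV.asEquivalence.counitIso.inv.app (K.1 : D₁)) ≫ β.hom.app (readBack αV Y K)) := by
    rw [hτ]
    change αE.asEquivalence.functor.map (αE.asEquivalence.inverse.map _ ≫
      αE.asEquivalence.unitIso.inv.app _) = _
    rw [Functor.map_comp, αE.asEquivalence.fun_inv_map]
    change _ ≫ αE.asEquivalence.functor.map (αE.asEquivalence.unitInv.app _) = _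
    rw [← αE.asEquivalence.counit_app_functor, Category.assoc, Category.assoc]
    change αE.asEquivalence.counitIso.hom.app _ ≫ _ ≫ αE.asEquivalence.counitIso.inv.app _ ≫
      αE.asEquivalence.counitIso.hom.app _ = _
    rw [Iso.inv_hom_id_app, Category.comp_id]
  have h2 : β.hom.app (readBack αV Y K) ≫ αE.map (G.map (readBackHom αV Y K)) =
      pbH.map (αV.map (readBackHom αV Y K)) ≫ β.hom.app Y := by
    have := β.hom.naturality (readBackHom αV Y K)
    simpa using this.symm
  have h3 : αV.map (readBackHom αV Y K) = αV.asEquivalence.counitIso.hom.app (K.1 : D₁) ≫ K.1.arrow :=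
    map_readBackHom αV Y K
  have hclaim : τ ≫ G.map (readBackHom αV Y K) ≫ γ.hom = readBackHom αE Y' L := by
    apply αE.map_injective
    calc αE.map (τ ≫ G.map (readBackHom αV Y K) ≫ γ.hom)
        = αE.map τ ≫ (αE.map (G.map (readBackHom αV Y K)) ≫ αE.map γ.hom) := by
          rw [αE.map_comp, αE.map_comp]
      _ = αE.asEquivalence.counitIso.hom.app (L.1 : D₂) ≫ t ≫
            pbH.map (αV.asEquivalence.counitIso.inv.app (K.1 : D₁)) ≫
            (β.hom.app (readBack αV Y K) ≫ αE.map (G.map (readBackHom αV Y K))) ≫ αE.map γ.hom := by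
          rw [h1]; simp only [Category.assoc]
      _ = αE.asEquivalence.counitIso.hom.app (L.1 : D₂) ≫ t ≫
            pbH.map (αV.asEquivalence.counitIso.inv.app (K.1 : D₁)) ≫
            pbH.map (αV.asEquivalence.counitIso.hom.app (K.1 : D₁)) ≫
            pbH.map K.1.arrow ≫ β.hom.app Y ≫ αE.map γ.hom := by
          rw [h2, h3, pbH.map_comp]; simp only [Category.assoc]
      _ = αE.asEquivalence.counitIso.hom.app (L.1 : D₂) ≫
            (t ≫ pbH.map K.1.arrow ≫ β.hom.app Y ≫ αE.map γ.hom) := by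
          rw [← pbH.map_comp_assoc, Iso.inv_hom_id_app]
          erw [CategoryTheory.Functor.map_id, Category.id_comp]
      _ = αE.asEquivalence.counitIso.hom.app (L.1 : D₂) ≫ L.1.arrow := by rw [ht]
      _ = αE.map (readBackHom αE Y' L) := (map_readBackHom αE Y' L).symm
  -- read off the underlying morphisms
  refine ⟨(Subobject.underlyingIso ((readBackHom αE Y' L).left ≫ fst')).hom ≫ τ.left ≫
      pr (readBack αV Y K) ≫
      pbK.map (Subobject.underlyingIso ((readBackHom αV Y K).left ≫ fst)).inv, ?_⟩
  have hK : (Subobject.underlyingIso ((readBackHom αV Y K).left ≫ fst)).inv ≫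
      (componentIn αV Y fst K).1.arrow = (readBackHom αV Y K).left ≫ fst :=
    underlyingIso_inv_componentIn_arrow αV Y fst K
  calc ((Subobject.underlyingIso ((readBackHom αE Y' L).left ≫ fst')).hom ≫ τ.left ≫
          pr (readBack αV Y K) ≫
          pbK.map (Subobject.underlyingIso ((readBackHom αV Y K).left ≫ fst)).inv) ≫
        pbK.map (componentIn αV Y fst K).1.arrow ≫ gl
      = (Subobject.underlyingIso ((readBackHom αE Y' L).left ≫ fst')).hom ≫ τ.left ≫
          pr (readBack αV Y K) ≫ pbK.map ((readBackHom αV Y K).left ≫ fst) ≫ gl := by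
        simp only [Category.assoc]
        rw [← pbK.map_comp_assoc, hK]
    _ = (Subobject.underlyingIso ((readBackHom αE Y' L).left ≫ fst')).hom ≫
          (τ ≫ G.map (readBackHom αV Y K) ≫ γ.hom).left ≫ fst' := by
        simp only [Over.comp_left, Category.assoc]
        rw [pbK.map_comp_assoc, hγ, reassoc_of% (hpr (readBackHom αV Y K))]
    _ = (Subobject.underlyingIso ((readBackHom αE Y' L).left ≫ fst')).hom ≫
          (readBackHom αE Y' L).left ≫ fst' := by rw [hclaim]
    _ = (componentIn αE Y' fst' L).1.arrow := Subobject.underlyingIso_hom_comp_eq_mk _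

end Branch

/-! ### The labels of the composite -/

namespace Hom.AlignedLocalData

variable {𝒢 ℋ 𝒦 : SemiGraphOfAnabelioids.{v₁, u₁, u}} {ψ : Hom ℋ 𝒦} {A : 𝒦.BObj}
  (𝔇 : ψ.AlignedLocalData A) (X : Over A)

/-- The piece `X_u ×_{A_u} P_w ↪ X_u` (a pull-back of the monomorphism `P_w ↪ A_u`).
[cite: MochizukiSemiAnbd2006, Def. 2.2(i) p.23] -/
noncomputable abbrev pieceVIncl (w : ℋ.graph.Vertex) :
    ((𝔇.pieceV w).obj X).left ⟶ X.left.S (ψ.base.vertexMap w) :=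
  pullback.fst _ _

/-- The piece `X_{e₀} ×_{A_{e₀}} Q_f ↪ X_{e₀}`. [cite: MochizukiSemiAnbd2006, Def. 2.2(i) p.23] -/
noncomputable abbrev pieceEIncl (f : ℋ.graph.Edge) (e₀ : 𝒦.graph.Edge) (p : ψ.base.edgeMap f = e₀) :
    ((𝔇.pieceE f e₀ p).obj X).left ⟶ X.left.T e₀ :=
  pullback.fst _ _

/-- **Vertex labels of the composite**: a component `K` of `(lift X)_w = αV_w (X_u ×_{A_u} P_w)` names the
component `(αV⁻¹ K).left ↪ X_u ×_{A_u} P_w ↪ X_u` of `X_u`. [cite: MochizukiSemiAnbd2006, Def. 2.2(i) p.23] -/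
noncomputable def compV (w : ℋ.graph.Vertex) (K : π₀Obj ((𝔇.lift.obj X).S w)) :
    π₀Obj (X.left.S (ψ.base.vertexMap w)) := by
  haveI := 𝔇.αV_isEquivalence w
  exact componentIn (𝔇.αV w) ((𝔇.pieceV w).obj X) (𝔇.pieceVIncl X w) K

/-- Edge labels of the composite, at a presentation `ψ f = e₀` of the image edge.
[cite: MochizukiSemiAnbd2006, Def. 2.2(i) p.23] -/
noncomputable def compEAt (f : ℋ.graph.Edge) (e₀ : 𝒦.graph.Edge) (p : ψ.base.edgeMap f = e₀)
    (K : π₀Obj ((𝔇.αE f e₀ p).obj ((𝔇.pieceE f e₀ p).obj X))) : π₀Obj (X.left.T e₀) := by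
  haveI := 𝔇.αE_isEquivalence f e₀ p
  exact componentIn (𝔇.αE f e₀ p) ((𝔇.pieceE f e₀ p).obj X) (𝔇.pieceEIncl X f e₀ p) K

/-- **Edge labels of the composite** (canonical presentation of the image edge).
[cite: MochizukiSemiAnbd2006, Def. 2.2(i) p.23] -/
noncomputable def compE (f : ℋ.graph.Edge) (K : π₀Obj ((𝔇.lift.obj X).T f)) :
    π₀Obj (X.left.T (ψ.base.edgeMap f)) :=
  𝔇.compEAt X f _ rfl K

/-- The vertex label of the composite lies over the vertex label `P_w` of `ψ`.
[cite: MochizukiSemiAnbd2006, Def. 2.2(i) p.23] -/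
theorem componentUnder_compV (w : ℋ.graph.Vertex) (K : π₀Obj ((𝔇.lift.obj X).S w)) :
    componentUnder (X.hom.fS (ψ.base.vertexMap w)) (𝔇.compV X w K) = 𝔇.cV w := by
  haveI := 𝔇.αV_isEquivalence w
  refine componentUnder_eq _ _
    ((Subobject.underlyingIso ((readBackHom (𝔇.αV w) ((𝔇.pieceV w).obj X) K).left ≫
        𝔇.pieceVIncl X w)).hom ≫
      (readBackHom (𝔇.αV w) ((𝔇.pieceV w).obj X) K).left ≫ pullback.snd _ _) ?_
  rw [Category.assoc, Category.assoc, ← pullback.condition]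
  change _ = (Subobject.mk _).arrow ≫ _
  rw [← Subobject.underlyingIso_hom_comp_eq_mk, Category.assoc, Category.assoc]
  rfl

/-- The edge label of the composite lies over the edge label `Q_f` of `ψ`.
[cite: MochizukiSemiAnbd2006, Def. 2.2(i) p.23] -/
theorem componentUnder_compE (f : ℋ.graph.Edge) (K : π₀Obj ((𝔇.lift.obj X).T f)) :
    componentUnder (X.hom.fT (ψ.base.edgeMap f)) (𝔇.compE X f K) = 𝔇.cE f _ rfl := by
  haveI := 𝔇.αE_isEquivalence f _ rfl
  refine componentUnder_eq _ _
    ((Subobject.underlyingIso ((readBackHom (𝔇.αE f _ rfl) ((𝔇.pieceE f _ rfl).obj X) K).left ≫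
        𝔇.pieceEIncl X f _ rfl)).hom ≫
      (readBackHom (𝔇.αE f _ rfl) ((𝔇.pieceE f _ rfl).obj X) K).left ≫ pullback.snd _ _) ?_
  rw [Category.assoc, Category.assoc, ← pullback.condition]
  change _ = (Subobject.mk _).arrow ≫ _
  rw [← Subobject.underlyingIso_hom_comp_eq_mk, Category.assoc, Category.assoc]
  rfl

/-- **Vertices**: `(w, K) ↦ (ψ w, compV K)` is a bijection from `Σ w, π₀((lift X)_w)` onto
`Σ u, π₀(X_u)`. [cite: MochizukiSemiAnbd2006, Def. 2.2(i) p.23] -/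
theorem sigmaV_bijective :
    Function.Bijective (fun q : (Σ w : ℋ.graph.Vertex, π₀Obj ((𝔇.lift.obj X).S w)) =>
      (⟨ψ.base.vertexMap q.1, 𝔇.compV X q.1 q.2⟩ : Σ u, π₀Obj (X.left.S u))) := by
  constructor
  · rintro ⟨w₁, K₁⟩ ⟨w₂, K₂⟩ h
    have hlab := congrArg (fun q : (Σ u, π₀Obj (X.left.S u)) =>
      (⟨q.1, componentUnder (X.hom.fS q.1) q.2⟩ : Σ u, π₀Obj (A.S u))) h
    simp only [componentUnder_compV] at hlab
    obtain rfl : w₁ = w₂ := 𝔇.cV_bijective.1 hlab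
    obtain ⟨-, hK⟩ := Sigma.mk.inj_iff.mp h
    haveI := 𝔇.αV_isEquivalence w₁
    obtain rfl : K₁ = K₂ := componentIn_injective _ _ _ (eq_of_heq hK)
    rfl
  · rintro ⟨u, K₀⟩
    obtain ⟨w, hw⟩ := 𝔇.cV_bijective.2 ⟨u, componentUnder (X.hom.fS u) K₀⟩
    obtain ⟨rfl, hP⟩ := Sigma.mk.inj_iff.mp hw
    have hP' : 𝔇.cV w = componentUnder (X.hom.fS (ψ.base.vertexMap w)) K₀ := eq_of_heq hP
    obtain ⟨k, hk⟩ := exists_factor_componentUnder (X.hom.fS (ψ.base.vertexMap w)) K₀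
    have hle' : (componentUnder (X.hom.fS (ψ.base.vertexMap w)) K₀).1 ≤ (𝔇.cV w).1 :=
      le_of_eq (congrArg Subtype.val hP'.symm)
    have hle : K₀.1 ≤ Subobject.mk (𝔇.pieceVIncl X w) :=
      Subobject.le_mk_of_comm
        (pullback.lift K₀.1.arrow (k ≫ Subobject.ofLE _ _ hle')
          (by rw [Category.assoc, Subobject.ofLE_arrow, hk]; rfl))
        (pullback.lift_fst _ _ _)
    haveI := 𝔇.αV_isEquivalence w
    obtain ⟨K, hK⟩ := exists_componentIn_eq (𝔇.αV w) ((𝔇.pieceV w).obj X) (𝔇.pieceVIncl X w) K₀ hle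
    exact ⟨⟨w, K⟩, Sigma.ext rfl (heq_of_eq hK)⟩

/-- **Edges**: `(f, K) ↦ (ψ f, compE K)` is a bijection from `Σ f, π₀((lift X)_f)` onto `Σ e, π₀(X_e)`.
[cite: MochizukiSemiAnbd2006, Def. 2.2(i) p.23] -/
theorem sigmaE_bijective :
    Function.Bijective (fun q : (Σ f : ℋ.graph.Edge, π₀Obj ((𝔇.lift.obj X).T f)) =>
      (⟨ψ.base.edgeMap q.1, 𝔇.compE X q.1 q.2⟩ : Σ e, π₀Obj (X.left.T e))) := by
  constructor
  · rintro ⟨f₁, K₁⟩ ⟨f₂, K₂⟩ h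
    have hlab := congrArg (fun q : (Σ e, π₀Obj (X.left.T e)) =>
      (⟨q.1, componentUnder (X.hom.fT q.1) q.2⟩ : Σ e, π₀Obj (A.T e))) h
    simp only [componentUnder_compE] at hlab
    obtain rfl : f₁ = f₂ := 𝔇.cE_bijective.1 hlab
    obtain ⟨-, hK⟩ := Sigma.mk.inj_iff.mp h
    haveI := 𝔇.αE_isEquivalence f₁ _ rfl
    obtain rfl : K₁ = K₂ := componentIn_injective _ _ _ (eq_of_heq hK)
    rfl
  · rintro ⟨e, K₀⟩
    obtain ⟨f, hf⟩ := 𝔇.cE_bijective.2 ⟨e, componentUnder (X.hom.fT e) K₀⟩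
    obtain ⟨rfl, hQ⟩ := Sigma.mk.inj_iff.mp hf
    have hQ' : 𝔇.cE f _ rfl = componentUnder (X.hom.fT (ψ.base.edgeMap f)) K₀ := eq_of_heq hQ
    obtain ⟨k, hk⟩ := exists_factor_componentUnder (X.hom.fT (ψ.base.edgeMap f)) K₀
    have hle' : (componentUnder (X.hom.fT (ψ.base.edgeMap f)) K₀).1 ≤ (𝔇.cE f _ rfl).1 :=
      le_of_eq (congrArg Subtype.val hQ'.symm)
    have hle : K₀.1 ≤ Subobject.mk (𝔇.pieceEIncl X f _ rfl) :=
      Subobject.le_mk_of_comm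
        (pullback.lift K₀.1.arrow (k ≫ Subobject.ofLE _ _ hle')
          (by rw [Category.assoc, Subobject.ofLE_arrow, hk]; rfl))
        (pullback.lift_fst _ _ _)
    haveI := 𝔇.αE_isEquivalence f _ rfl
    obtain ⟨K, hK⟩ :=
      exists_componentIn_eq (𝔇.αE f _ rfl) ((𝔇.pieceE f _ rfl).obj X) (𝔇.pieceEIncl X f _ rfl) K₀ hle
    exact ⟨⟨f, K⟩, Sigma.ext rfl (heq_of_eq hK)⟩

/-! ### The branch clause of the composite -/

/-- The edge object of the lift at a presentation of the image edge.
[cite: MochizukiSemiAnbd2006, Def. 2.2(i) p.23] -/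
theorem lift_obj_T_eq (f : ℋ.graph.Edge) (e₀ : 𝒦.graph.Edge) (p : ψ.base.edgeMap f = e₀) :
    (𝔇.lift.obj X).T f = (𝔇.αE f e₀ p).obj ((𝔇.pieceE f e₀ p).obj X) := by
  subst p; rfl

/-- Coherence of the edge labels of the composite across presentations: reading a component of
`(lift X)_{f₁}`, transported from `f₂ = f₁` and into the presentation `ψ f₁ = e₁`, back through
`αE_{f₁,e₁}` gives the canonical label at `f₂` cast to `e₁`. [cite: MochizukiSemiAnbd2006, Def. 2.2(i) p.23] -/
theorem compEAt_castObj_eq_castT_compE (f : ℋ.graph.Edge) (e₁ : 𝒦.graph.Edge)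
    (p : ψ.base.edgeMap f = e₁) (L : π₀Obj ((𝔇.lift.obj X).T f)) :
    𝔇.compEAt X f e₁ p (castObj (𝔇.lift_obj_T_eq X f e₁ p) L) = X.left.castT p.symm (𝔇.compE X f L) := by
  subst p; rfl

/-- Coherence of the edge labels along an equality of edges of `ℋ` (home edge of a branch versus the
image edge). [cite: MochizukiSemiAnbd2006, Def. 2.2(i) p.23] -/
theorem castT_compE_castT {f₁ f₂ : ℋ.graph.Edge} (hf : f₁ = f₂) (L₂ : π₀Obj ((𝔇.lift.obj X).T f₂))
    {e₁ : 𝒦.graph.Edge} (p₁ : e₁ = ψ.base.edgeMap f₁) :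
    X.left.castT p₁ (𝔇.compE X f₁ ((𝔇.lift.obj X).castT hf L₂)) =
      X.left.castT (show e₁ = ψ.base.edgeMap f₂ by rw [p₁, hf]) (𝔇.compE X f₂ L₂) := by
  subst hf; rfl

/-- **The branch clause of the composite**, at a branch `b₁` of `ℋ` at `w` (home presentation):
a component `L` of `(lift X)_{edgeOf b₁}` lying under `b₁^* K` through the gluing of the lift names a
component of `X_{edgeOf b₀}` lying under `b₀^*` of the component named by `K` through the gluing of `X`
(`b₀ = ψ b₁`). [cite: MochizukiSemiAnbd2006, Def. 2.2(i) p.23] -/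
theorem exists_fac_compE_of_fac (b₁ : ℋ.graph.Branch) (w : ℋ.graph.Vertex)
    (h₁ : ℋ.graph.abuts b₁ = some w) (K : π₀Obj ((𝔇.lift.obj X).S w))
    (L : π₀Obj ((𝔇.lift.obj X).T (ℋ.graph.edgeOf b₁)))
    (t : (L.1 : ℋ.E (ℋ.graph.edgeOf b₁)) ⟶ (ℋ.pull b₁ w h₁).pullback.obj (K.1 : ℋ.V w))
    (ht : t ≫ (ℋ.pull b₁ w h₁).pullback.map K.1.arrow ≫ ((𝔇.lift.obj X).ψ b₁ w h₁).hom = L.1.arrow) :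
    ∃ s : ((X.left.castT (ψ.base.edgeOf_branchMap b₁) (𝔇.compE X (ℋ.graph.edgeOf b₁) L)).1 :
          𝒦.E (𝒦.graph.edgeOf (ψ.base.branchMap b₁))) ⟶
        (𝒦.pull (ψ.base.branchMap b₁) (ψ.base.vertexMap w) (ψ.base.abuts_branchMap b₁ w h₁)).pullback.obj
          ((𝔇.compV X w K).1 : 𝒦.V (ψ.base.vertexMap w)),
      s ≫ (𝒦.pull (ψ.base.branchMap b₁) (ψ.base.vertexMap w)
            (ψ.base.abuts_branchMap b₁ w h₁)).pullback.map (𝔇.compV X w K).1.arrow ≫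
          (X.left.ψ (ψ.base.branchMap b₁) (ψ.base.vertexMap w) (ψ.base.abuts_branchMap b₁ w h₁)).hom =
        (X.left.castT (ψ.base.edgeOf_branchMap b₁) (𝔇.compE X (ℋ.graph.edgeOf b₁) L)).1.arrow := by
  haveI := 𝔇.αV_isEquivalence w
  haveI := 𝔇.αE_isEquivalence (ℋ.graph.edgeOf b₁) (𝒦.graph.edgeOf (ψ.base.branchMap b₁))
    (ψ.base.edgeOf_branchMap b₁).symm
  -- move `L` into the home presentation of the image edge
  let L' : π₀Obj ((𝔇.αE (ℋ.graph.edgeOf b₁) _ (ψ.base.edgeOf_branchMap b₁).symm).obj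
      ((𝔇.pieceBr b₁).obj X)) :=
    castObj (𝔇.lift_obj_T_eq X (ℋ.graph.edgeOf b₁) _ (ψ.base.edgeOf_branchMap b₁).symm) L
  have hψ := 𝔇.lift_obj_ψ_hom X b₁ w h₁
  rw [hψ] at ht
  obtain ⟨t', ht'⟩ := exists_fac_castObj
    (𝔇.lift_obj_T_eq X (ℋ.graph.edgeOf b₁) _ (ψ.base.edgeOf_branchMap b₁).symm).symm L
    ((ℋ.pull b₁ w h₁).pullback.map K.1.arrow ≫
      (𝔇.β b₁ w h₁).hom.app ((𝔇.pieceV w).obj X) ≫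
        (𝔇.αE (ℋ.graph.edgeOf b₁) _ (ψ.base.edgeOf_branchMap b₁).symm).map (𝔇.glueApp b₁ w h₁ X).hom)
    t (by
      simp only [eqToIso.hom, eqToHom_app] at ht
      simpa only [Category.assoc] using ht)
  -- the abstract branch step
  obtain ⟨s, hs⟩ := componentIn_branch (𝔇.αV w)
    (𝔇.αE (ℋ.graph.edgeOf b₁) _ (ψ.base.edgeOf_branchMap b₁).symm) (ℋ.pull b₁ w h₁).pullback
    (𝔇.gluingAt b₁ w h₁) (𝔇.β b₁ w h₁)
    (𝒦.pull (ψ.base.branchMap b₁) (ψ.base.vertexMap w) (ψ.base.abuts_branchMap b₁ w h₁)).pullback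
    (fun U => pullback.fst _ _) (fun g => 𝔇.gluingAt_map_left_fst b₁ w h₁ g)
    ((𝔇.pieceV w).obj X) ((𝔇.pieceBr b₁).obj X) (𝔇.glueApp b₁ w h₁ X)
    (𝔇.pieceVIncl X w) (𝔇.pieceEIncl X _ _ (ψ.base.edgeOf_branchMap b₁).symm)
    (X.left.ψ (ψ.base.branchMap b₁) (ψ.base.vertexMap w) (ψ.base.abuts_branchMap b₁ w h₁)).hom
    (𝔇.glueApp_hom_left_fst b₁ w h₁ X) K L' t' (by simpa only [Category.assoc] using ht')
  have hR := 𝔇.compEAt_castObj_eq_castT_compE X (ℋ.graph.edgeOf b₁) _ (ψ.base.edgeOf_branchMap b₁).symm L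
  rw [← hR]
  exact ⟨s, hs⟩

end Hom.AlignedLocalData

/-! ### The local clause of a composite -/

variable {𝒢 ℋ 𝒦 : SemiGraphOfAnabelioids.{v₁, u₁, u}}

/-- **[SemiAnbd] Def. 2.2 (i) under composition (Rmk. 2.4.2), LOCAL clause.**  Let `ψ : ℋ → 𝒦` lie over
a proper morphism and carry aligned local data `𝔇` over `A ∈ B(𝒦)`, and let `χ : 𝒢 → ℋ` be, locally,
the finite étale covering attached to the lift `𝔇.lift X` of an object `X → A` of `B(𝒦)_{/A}`.  Then the
composite `χ.comp ψ : 𝒢 → 𝒦` is, locally, the finite étale covering attached to the object `X` of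
`B(𝒦)`: its vertices/edges over `u`/`e` are the connected components of `X_u`/`X_e` (read back through
`𝔇`'s local equivalences), its constituents the component anabelioids (iterated slices), and its
branches abut as the gluing of `X` dictates (the gluing of the lift being `β` followed by the gluing
square of `X`). [cite: MochizukiSemiAnbd2006, Def. 2.2(i) p.23] -/
theorem Hom.IsFiniteEtaleCoveringOf.comp_of_alignedLocalData {χ : Hom 𝒢 ℋ} {ψ : Hom ℋ 𝒦}
    {A : 𝒦.BObj} (𝔇 : ψ.AlignedLocalData A) (X : Over A) (hψ : SemiGraph.IsProper ψ.base)
    (hχ : χ.IsFiniteEtaleCoveringOf (𝔇.lift.obj X)) :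
    (χ.comp ψ).IsFiniteEtaleCoveringOf X.left := by
  obtain ⟨hprop, cVχ, cEχ, hVb, hEb, hV, hE, hbr⟩ := hχ
  refine ⟨SemiGraph.IsProper.comp hprop hψ, fun v => 𝔇.compV X (χ.base.vertexMap v) (cVχ v),
    fun e => 𝔇.compE X (χ.base.edgeMap e) (cEχ e), (𝔇.sigmaV_bijective X).comp hVb,
    (𝔇.sigmaE_bijective X).comp hEb, ?_, ?_, ?_⟩
  · -- vertex constituents: `ψ_w^* ⋙ χ_v^* ≅ (P × −) ⋙ αV ⋙ (K × −) ⋙ αχ ≅ (cV'' × −) ⋙ E ⋙ αχ`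
    intro v
    obtain ⟨αχ, hαχ, ⟨eχ⟩⟩ := hV v
    haveI := hαχ
    haveI := 𝔇.αV_isEquivalence (χ.base.vertexMap v)
    obtain ⟨E, hE', ⟨σ⟩⟩ := exists_sliceEquiv_componentIn (𝔇.αV (χ.base.vertexMap v))
      ((𝔇.pieceV (χ.base.vertexMap v)).obj X) (𝔇.pieceVIncl X (χ.base.vertexMap v)) (cVχ v)
    haveI := hE'
    refine ⟨E ⋙ αχ, inferInstance, ⟨?_⟩⟩
    exact Functor.isoWhiskerRight (𝔇.εV (χ.base.vertexMap v)) (χ.φV v).pullback ≪≫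
      Functor.isoWhiskerLeft _ eχ ≪≫ Functor.isoWhiskerRight σ αχ
  · -- edge constituents
    intro e
    obtain ⟨αχ, hαχ, ⟨eχ⟩⟩ := hE e
    haveI := hαχ
    haveI := 𝔇.αE_isEquivalence (χ.base.edgeMap e) _ rfl
    obtain ⟨E, hE', ⟨σ⟩⟩ := exists_sliceEquiv_componentIn (𝔇.αE (χ.base.edgeMap e) _ rfl)
      ((𝔇.pieceE (χ.base.edgeMap e) _ rfl).obj X) (𝔇.pieceEIncl X (χ.base.edgeMap e) _ rfl) (cEχ e)
    haveI := hE'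
    refine ⟨E ⋙ αχ, inferInstance, ⟨?_⟩⟩
    exact Functor.isoWhiskerRight (𝔇.εE (χ.base.edgeMap e) _ rfl)
        (χ.φE e (χ.base.edgeMap e) rfl).pullback ≪≫
      Functor.isoWhiskerLeft _ eχ ≪≫ Functor.isoWhiskerRight σ αχ
  · -- branches: unpack `χ`'s clause at the home edge of `ℋ`, run the branch step, repack in `𝒦`
    intro b v h
    obtain ⟨t, ht⟩ := hbr b v h
    obtain ⟨t', ht'⟩ := (𝔇.lift.obj X).exists_fac_castT_of_transport (χ.base.edgeOf_branchMap b)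
      (cEχ (𝒢.graph.edgeOf b)) _ t ht
    obtain ⟨s, hs⟩ := 𝔇.exists_fac_compE_of_fac X (χ.base.branchMap b) (χ.base.vertexMap v)
      (χ.base.abuts_branchMap b v h) (cVχ v) _ t' ht'
    haveI := X.left.mono_map_arrow_comp_ψ (ψ.base.branchMap (χ.base.branchMap b))
      (ψ.base.vertexMap (χ.base.vertexMap v))
      (ψ.base.abuts_branchMap _ _ (χ.base.abuts_branchMap b v h))
      (𝔇.compV X (χ.base.vertexMap v) (cVχ v)).1
    have hle := Subobject.le_mk_of_comm s hs
    rw [𝔇.castT_compE_castT X (χ.base.edgeOf_branchMap b) (cEχ (𝒢.graph.edgeOf b))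
      (ψ.base.edgeOf_branchMap (χ.base.branchMap b))] at hle
    exact X.left.exists_transport_of_fac_castT ((χ.comp ψ).base.edgeOf_branchMap b)
      (𝔇.compE X (χ.base.edgeMap (𝒢.graph.edgeOf b)) (cEχ (𝒢.graph.edgeOf b))) _
      (Subobject.ofLEMk _ _ hle) (Subobject.ofLEMk_comp hle)

end SemiGraphOfAnabelioids

end Literature.AnabelianGeometry.SemiGraphs
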